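import Mathlib.Topology.Algebra.OpenSubgroup
import Mathlib.Topology.Algebra.ClopenNhdofOne
import Mathlib.GroupTheory.GroupAction.Quotient
import Mathlib.GroupTheory.Index
import Mathlib.Data.Fintype.EquivFin
import Literature.AnabelianGeometry.AbsoluteAnabelian.ProfiniteTerminology
import HarnessLib

/-!
# Topologically finitely generated groups have finitely many open subgroups of each index; profinite ones are Galois-countable

Mochizuki, *Inter-universal Teichmüller theory I*, Remark 2.5.3 (ii) (E2), kurims manuscript (May
2020) p. 53: the tamely ramified arithmetic fundamental group of `U` "is itself Galois-countable
[cf., e.g., [AbsTopI], Proposition 2.2]" — i.e. topological finite generation ([AbsTopI] Prop. 2.2,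
abc-iut-L4-t4's `FundamentalExtension.GeomTFG`) yields Galois-countability [(T1) p. 52: "its topology
admits a countable basis"].  This Mathlib-only file (plus the tree's `IsTopologicallyFinitelyGenerated`,
[AbsTopI] §0) proves the group-theoretic mechanism (abc-iut cell, layer L5, abc-iut-L5-t6; reusable by
abc-iut-L3 for [IUTchI] Rmk. 2.5.3 (i) (T4)):

* `IsTopologicallyFinitelyGenerated.finite_setOf_isOpen_index` — a topologically finitely generated
  topological group has only finitely many OPEN subgroups of any given finite index `n ≠ 0`: an open
  subgroup of index `n` is the stabilizer of a point for a homomorphism `ρ : G → 𝔖_n` with open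
  kernel, and such a `ρ` is determined by its values on a finite topologically generating set (the
  agreement locus of two of them is an open, hence closed, subgroup).  (The case `n = 2` is
  `finite_setOf_isOpen_index_two` of `NFGaloisNotTFGProofs.lean`.)
* `IsTopologicallyFinitelyGenerated.countable_setOf_isOpen_finiteIndex` — hence countably many open
  subgroups of finite index; for compact `G` (`countable_setOf_isOpen`) countably many open subgroups.
* `IsTopologicallyFinitelyGenerated.secondCountableTopology` — a topologically finitely generated
  PROFINITE group (compact, totally disconnected) is second countable ("Galois-countable"): the
  cosets of the open subgroups form a countable basis.

Elementary; no side is taken on [IUTchIII] Cor. 3.12.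
-/

open scoped Pointwise
open Topology TopologicalSpace

namespace Literature.AnabelianGeometry.AbsoluteAnabelian

namespace IsTopologicallyFinitelyGenerated

universe u

variable {G : Type u} [Group G] [TopologicalSpace G] [IsTopologicalGroup G]

/-- Two homomorphisms to a group with OPEN kernels that agree on a topologically generating set are
equal. [cite: Mochizuki2012, IUTchI Rmk 2.5.3 (ii) (E2) p.53] -/
theorem monoidHom_eq_of_eqOn {M : Type*} [Group M] {s : Finset G}
    (hs : (Subgroup.closure (s : Set G)).topologicalClosure = ⊤) {ρ ρ' : G →* M}
    (hρ : IsOpen (ρ.ker : Set G)) (hρ' : IsOpen (ρ'.ker : Set G))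
    (h : Set.EqOn ρ ρ' (s : Set G)) : ρ = ρ' := by
  -- the agreement locus is a subgroup containing the open subgroup `ker ρ ⊓ ker ρ'`
  have hle : ρ.ker ⊓ ρ'.ker ≤ ρ.eqLocus ρ' := by
    intro g hg
    change ρ g = ρ' g
    rw [(MonoidHom.mem_ker).mp hg.1, (MonoidHom.mem_ker).mp hg.2]
  have hopen : IsOpen (ρ.eqLocus ρ' : Set G) :=
    Subgroup.isOpen_mono hle (hρ.inter hρ')
  have hclosed : IsClosed (ρ.eqLocus ρ' : Set G) := Subgroup.isClosed_of_isOpen _ hopen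
  have hcl : Subgroup.closure (s : Set G) ≤ ρ.eqLocus ρ' := (Subgroup.closure_le _).mpr h
  have htop : ρ.eqLocus ρ' = ⊤ := by
    rw [eq_top_iff, ← hs]
    exact Subgroup.topologicalClosure_minimal _ hcl hclosed
  ext g
  have hg : g ∈ ρ.eqLocus ρ' := by rw [htop]; exact Subgroup.mem_top g
  exact hg

/-- The homomorphisms to a finite group with open kernel form a finite set, if `G` is topologically
finitely generated. [cite: Mochizuki2012, IUTchI Rmk 2.5.3 (ii) (E2) p.53] -/
theorem finite_setOf_monoidHom_isOpen_ker {M : Type*} [Group M] [Finite M]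
    (hG : IsTopologicallyFinitelyGenerated G) :
    {ρ : G →* M | IsOpen (ρ.ker : Set G)}.Finite := by
  classical
  obtain ⟨s, hs⟩ := hG.exists_finset
  refine Set.Finite.of_finite_image (f := fun ρ : G →* M => fun x : (s : Set G) => ρ x)
    (Set.toFinite _) ?_
  intro ρ hρ ρ' hρ' hf
  refine monoidHom_eq_of_eqOn hs hρ hρ' fun x hx => ?_
  exact congrFun hf ⟨x, hx⟩

omit [TopologicalSpace G] [IsTopologicalGroup G] in
/-- The permutation representation `g ↦ e ∘ (g • ·) ∘ e⁻¹` on `Fin n` attached to a subgroup `U` and a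
numbering `e` of its cosets (Mathlib's `MulAction.toPermHom` conjugated by `e.permCongrHom`), evaluated.
[cite: Mochizuki2012, IUTchI Rmk 2.5.3 (ii) (E2) p.53] -/
theorem permRep_apply (U : Subgroup G) {n : ℕ} (e : G ⧸ U ≃ Fin n) (g : G) (i : Fin n) :
    (e.permCongrHom.toMonoidHom.comp (MulAction.toPermHom G (G ⧸ U))) g i = e (g • e.symm i) := rfl

omit [IsTopologicalGroup G] in
/-- The stabilizer of a coset of an open subgroup is open.
[cite: Mochizuki2012, IUTchI Rmk 2.5.3 (ii) (E2) p.53] -/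
theorem isOpen_setOf_smul_eq [ContinuousMul G] (U : Subgroup G) (hU : IsOpen (U : Set G))
    (q : G ⧸ U) : IsOpen {g : G | g • q = q} := by
  obtain ⟨a, rfl⟩ := QuotientGroup.mk_surjective q
  have : {g : G | g • (a : G ⧸ U) = a} = (fun g => a⁻¹ * g * a) ⁻¹' (U : Set G) := by
    ext g
    simp only [Set.mem_setOf_eq, Set.mem_preimage, SetLike.mem_coe, MulAction.Quotient.smul_coe,
      smul_eq_mul, QuotientGroup.eq]
    rw [show (g * a)⁻¹ * a = (a⁻¹ * g * a)⁻¹ by group, inv_mem_iff]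
  rw [this]
  exact hU.preimage ((continuous_const.mul continuous_id).mul continuous_const)

omit [IsTopologicalGroup G] in
/-- The kernel of the permutation representation of an open subgroup of finite index is open.
[cite: Mochizuki2012, IUTchI Rmk 2.5.3 (ii) (E2) p.53] -/
theorem isOpen_ker_permRep [ContinuousMul G] (U : Subgroup G) (hU : IsOpen (U : Set G)) {n : ℕ}
    [Finite (G ⧸ U)] (e : G ⧸ U ≃ Fin n) :
    IsOpen ((e.permCongrHom.toMonoidHom.comp (MulAction.toPermHom G (G ⧸ U))).ker : Set G) := by
  have : ((e.permCongrHom.toMonoidHom.comp (MulAction.toPermHom G (G ⧸ U))).ker : Set G) =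
      ⋂ q : G ⧸ U, {g : G | g • q = q} := by
    ext g
    simp only [SetLike.mem_coe, MonoidHom.mem_ker, Set.mem_iInter, Set.mem_setOf_eq]
    constructor
    · intro h q
      have := congrArg (fun σ : Equiv.Perm (Fin n) => σ (e q)) h
      simpa [permRep_apply] using this
    · intro h
      ext i
      simp [h (e.symm i)]
  rw [this]
  exact isOpen_iInter_of_finite fun q => isOpen_setOf_smul_eq U hU q

omit [TopologicalSpace G] [IsTopologicalGroup G] in
/-- An open subgroup is the stabilizer of the point numbering its own coset.
[cite: Mochizuki2012, IUTchI Rmk 2.5.3 (ii) (E2) p.53] -/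
theorem eq_comap_stabilizer_permRep (U : Subgroup G) {n : ℕ} (e : G ⧸ U ≃ Fin n) :
    U = (MulAction.stabilizer (Equiv.Perm (Fin n)) (e ((1 : G) : G ⧸ U))).comap
      (e.permCongrHom.toMonoidHom.comp (MulAction.toPermHom G (G ⧸ U))) := by
  ext g
  simp only [Subgroup.mem_comap, MulAction.mem_stabilizer_iff, Equiv.Perm.smul_def, permRep_apply,
    Equiv.symm_apply_apply, Equiv.apply_eq_iff_eq, MulAction.Quotient.smul_coe, smul_eq_mul,
    mul_one]
  rw [eq_comm, QuotientGroup.eq, inv_one, one_mul]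

/-- **A topologically finitely generated topological group has only finitely many open subgroups
of each finite index.** [cite: Mochizuki2012, IUTchI Rmk 2.5.3 (ii) (E2) p.53] -/
theorem finite_setOf_isOpen_index (hG : IsTopologicallyFinitelyGenerated G) {n : ℕ} (hn : n ≠ 0) :
    {U : Subgroup G | IsOpen (U : Set G) ∧ U.index = n}.Finite := by
  classical
  -- every such `U` is the stabilizer of some point for some `ρ : G →* 𝔖_n` with open kernel
  let T : Set (G →* Equiv.Perm (Fin n)) := {ρ | IsOpen (ρ.ker : Set G)}
  have hT : T.Finite := finite_setOf_monoidHom_isOpen_ker hG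
  let F : (G →* Equiv.Perm (Fin n)) × Fin n → Subgroup G :=
    fun p => (MulAction.stabilizer (Equiv.Perm (Fin n)) p.2).comap p.1
  refine ((hT.prod (Set.finite_univ (α := Fin n))).image F).subset ?_
  rintro U ⟨hUo, hUi⟩
  haveI : U.FiniteIndex := Subgroup.finiteIndex_iff.mpr (hUi ▸ hn)
  haveI : Finite (G ⧸ U) := Subgroup.finite_quotient_of_finiteIndex
  letI : Fintype (G ⧸ U) := Fintype.ofFinite _
  have hcard : Fintype.card (G ⧸ U) = n := by
    rw [← Nat.card_eq_fintype_card, ← Subgroup.index, hUi]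
  let e : G ⧸ U ≃ Fin n := Fintype.equivFinOfCardEq hcard
  have hmem : (e.permCongrHom.toMonoidHom.comp (MulAction.toPermHom G (G ⧸ U)), e ((1 : G) : G ⧸ U)) ∈
      T ×ˢ (Set.univ : Set (Fin n)) :=
    Set.mk_mem_prod (isOpen_ker_permRep U hUo e) (Set.mem_univ _)
  exact ⟨_, hmem, (eq_comap_stabilizer_permRep U e).symm⟩

/-- A topologically finitely generated topological group has countably many open subgroups of finite
index. [cite: Mochizuki2012, IUTchI Rmk 2.5.3 (ii) (E2) p.53] -/
theorem countable_setOf_isOpen_finiteIndex (hG : IsTopologicallyFinitelyGenerated G) :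
    {U : Subgroup G | IsOpen (U : Set G) ∧ U.FiniteIndex}.Countable := by
  have : {U : Subgroup G | IsOpen (U : Set G) ∧ U.FiniteIndex} ⊆
      ⋃ n : ℕ, {U : Subgroup G | IsOpen (U : Set G) ∧ U.index = n + 1} := by
    rintro U ⟨hUo, hUf⟩
    obtain ⟨k, hk⟩ := Nat.exists_eq_succ_of_ne_zero (Subgroup.finiteIndex_iff.mp hUf)
    exact Set.mem_iUnion.mpr ⟨k, hUo, hk⟩
  refine Set.Countable.mono this (Set.countable_iUnion fun k => ?_)
  exact (finite_setOf_isOpen_index hG (Nat.succ_ne_zero k)).countable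

/-- A topologically finitely generated COMPACT topological group has countably many open subgroups.
[cite: Mochizuki2012, IUTchI Rmk 2.5.3 (ii) (E2) p.53] -/
theorem countable_setOf_isOpen [CompactSpace G] (hG : IsTopologicallyFinitelyGenerated G) :
    {U : Subgroup G | IsOpen (U : Set G)}.Countable := by
  refine (countable_setOf_isOpen_finiteIndex hG).mono ?_
  intro U hU
  haveI : Finite (G ⧸ U) := U.quotient_finite_of_isOpen hU
  exact ⟨hU, Subgroup.finiteIndex_of_finite_quotient⟩

/-- **[IUTchI] Remark 2.5.3 (ii) (E2) mechanism** ("[cf. [AbsTopI], Proposition 2.2]": topological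
finite generation ⇒ Galois-countability): a topologically finitely generated profinite group is
second countable — the cosets of its open subgroups form a countable basis of the topology.
[cite: Mochizuki2012, IUTchI Rmk 2.5.3 (ii) (E2) p.53] -/
theorem secondCountableTopology [CompactSpace G] [TotallyDisconnectedSpace G]
    (hG : IsTopologicallyFinitelyGenerated G) : SecondCountableTopology G := by
  classical
  -- the basis: fibres of the quotient maps by open subgroups
  let B : Set (Set G) := ⋃ U ∈ {U : Subgroup G | IsOpen (U : Set G)},
    Set.range fun q : G ⧸ U => (QuotientGroup.mk : G → G ⧸ U) ⁻¹' {q}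
  have hBc : B.Countable := by
    refine (countable_setOf_isOpen hG).biUnion fun U hU => ?_
    haveI : Finite (G ⧸ U) := U.quotient_finite_of_isOpen hU
    exact Set.countable_range _
  have hcoset : ∀ (U : Subgroup G), IsOpen (U : Set G) → ∀ a : G,
      IsOpen ((QuotientGroup.mk : G → G ⧸ U) ⁻¹' {(a : G ⧸ U)}) := by
    intro U hU a
    have : (QuotientGroup.mk : G → G ⧸ U) ⁻¹' {(a : G ⧸ U)} = (fun g => a⁻¹ * g) ⁻¹' (U : Set G) := by
      ext g
      simp only [Set.mem_preimage, Set.mem_singleton_iff, SetLike.mem_coe]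
      rw [QuotientGroup.eq, ← U.inv_mem_iff, mul_inv_rev, inv_inv]
    rw [this]
    exact hU.preimage (continuous_const.mul continuous_id)
  have hBasis : IsTopologicalBasis B := by
    apply isTopologicalBasis_of_isOpen_of_nhds
    · intro S hS
      obtain ⟨U, hU, hS⟩ := Set.mem_iUnion₂.mp hS
      obtain ⟨q, rfl⟩ := hS
      obtain ⟨a, rfl⟩ := QuotientGroup.mk_surjective q
      exact hcoset U hU a
    · intro a O haO hO
      have h1 : IsOpen ((fun g => a * g) ⁻¹' O) := hO.preimage (continuous_const.mul continuous_id)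
      obtain ⟨N, hN⟩ := ProfiniteGrp.exist_openNormalSubgroup_sub_open_nhds_of_one h1
        (show (1 : G) ∈ (fun g => a * g) ⁻¹' O by simpa using haO)
      refine ⟨(QuotientGroup.mk : G → G ⧸ N.toSubgroup) ⁻¹' {(a : G ⧸ N.toSubgroup)},
        Set.mem_iUnion₂.mpr ⟨N.toSubgroup, N.isOpen', ⟨(a : G ⧸ N.toSubgroup), rfl⟩⟩,
        rfl, ?_⟩
      intro g hg
      simp only [Set.mem_preimage, Set.mem_singleton_iff] at hg
      have hag : a⁻¹ * g ∈ N.toSubgroup := QuotientGroup.eq.mp hg.symm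
      have := hN hag
      simpa using this
  exact ⟨⟨B, hBc, hBasis.eq_generateFrom⟩⟩

end IsTopologicallyFinitelyGenerated

end Literature.AnabelianGeometry.AbsoluteAnabelian
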